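import Literature.Analysis.OperatorTheory.L2KernelIntegralOperatorRCLike
import Literature.Analysis.OperatorTheory.IntegralOperatorHilbertSchmidt
import HarnessLib

/-!
# An `L²`-kernel operator whose kernel has an absolutely summable rank-one expansion
# `K(x,y) = Σ_k λ_k u_k(x) conj w_k(y)`, `Σ_k |λ_k| ‖u_k‖ ‖w_k‖ < ∞`, IS the norm-convergent sum
# `T φ = Σ_k λ_k ⟨w_k, φ⟩ u_k` of the rank-one operators

LABEL (line 1): RH-FREE generic kernel-operator toolkit (theorems only; NO definition, NO named fact).  Used by
the "annulus road" under `Connes1999_thm_VII_4_rat` (cell `rh-crit`, sub-cell cc, row O1): step (iv-a) of the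
separated-remainder estimate — passing from the POINTWISE geometric expansion of the separated sinc kernel to
the OPERATOR expansion in `L²(ℝ)`.  WHAT THIS IS NOT: anything about RH.

Source.  M. Reed, B. Simon, *Methods of Modern Mathematical Physics I* (1972) [`ReedSimon1972`], §VI.6 Thm. VI.23
(an `L²` kernel defines a bounded operator by `(Tφ)(x) = ∫ K(x,y)φ(y)dy`, with `⟨ψ, Tφ⟩ = ∫∫ conj ψ K φ`) and
§VI.5 (finite-rank / trace-class expansions), PDF pp. 196–199; Fubini and dominated convergence for series.

## What is proved

* `integral_norm_mul_norm_le_of_memLp_two` — `∫ |f||g| ≤ ‖f‖₂ ‖g‖₂` (Cauchy–Schwarz for `L²` representatives);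
* `hasSum_inner_of_kernel_expansion` — the WEAK expansion
  `⟨η, Tφ⟩ = Σ_k λ_k ⟨η, u_k⟩⟨w_k, φ⟩` (Fubini on `X × Y`, dominated convergence for the series);
* **`hasSum_rankOne_of_kernel_expansion`** — the STRONG expansion `Tφ = Σ_k λ_k ⟨w_k, φ⟩ u_k` in norm.

No instance, notation or attribute; no `def`.
-/

noncomputable section

open MeasureTheory Function Filter
open scoped ENNReal InnerProductSpace ComplexConjugate Topology

namespace Literature.Analysis.OperatorTheory

/-! ### Cauchy–Schwarz for `L²` representatives -/

/-- **`∫ |f| |g| dμ ≤ ‖f‖_{L²} ‖g‖_{L²}`** for `f, g ∈ ℒ²` (Hölder with `p = q = 2`). [cite: ReedSimon1972, Thm. VI.23 (proof), PDF p. 199] -/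
theorem integral_norm_mul_norm_le_of_memLp_two {α : Type*} [MeasurableSpace α] {μ : Measure α}
    {f g : α → ℂ} (hf : MemLp f 2 μ) (hg : MemLp g 2 μ) :
    ∫ x, ‖f x‖ * ‖g x‖ ∂μ ≤ ‖hf.toLp f‖ * ‖hg.toLp g‖ := by
  have hf' : MemLp f (ENNReal.ofReal 2) μ := by rw [ENNReal.ofReal_ofNat]; exact hf
  have hg' : MemLp g (ENNReal.ofReal 2) μ := by rw [ENNReal.ofReal_ofNat]; exact hg
  have h := integral_mul_norm_le_Lp_mul_Lq (μ := μ) Real.HolderConjugate.two_two hf' hg'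
  have e : ∀ {u : α → ℂ} (hu : MemLp u 2 μ), (∫ a, ‖u a‖ ^ (2 : ℝ) ∂μ) ^ (1 / (2 : ℝ)) = ‖hu.toLp u‖ := by
    intro u hu
    rw [← Real.sqrt_eq_rpow]
    have h2 : (∫ a, ‖u a‖ ^ (2 : ℝ) ∂μ) = ∫ a, ‖u a‖ ^ 2 ∂μ := by simp_rw [Real.rpow_two]
    rw [h2, ← norm_toLp_sq_eq_integral_norm_sq hu, Real.sqrt_sq (norm_nonneg _)]
  rwa [e hf, e hg] at h

/-! ### From a pointwise rank-one expansion of the kernel to the operator expansion -/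

variable {X Y : Type*} [MeasurableSpace X] [MeasurableSpace Y] {μ : Measure X} {ν : Measure Y}
  [SFinite μ] [SFinite ν] {κ : Type*} [Countable κ]

/-- **Weak form.**  Let `T : L²(Y) → L²(X)` act a.e. by an `L²` kernel `K`, and let
`K(x, y) = Σ_k λ_k u_k(x) conj w_k(y)` pointwise with `u_k ∈ L²(X)`, `w_k ∈ L²(Y)` and
`Σ_k |λ_k| ‖u_k‖ ‖w_k‖ < ∞`.  Then for all `η, φ`: `Σ_k λ_k ⟨η, u_k⟩ ⟨w_k, φ⟩ = ⟨η, T φ⟩`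
(`⟨η, Tφ⟩ = ∫∫ conj η(x) K(x,y) φ(y)`, and the series may be integrated termwise since
`Σ_k |λ_k| ∫∫ |η u_k| ⊗ |w_k φ| ≤ ‖η‖‖φ‖ Σ_k |λ_k|‖u_k‖‖w_k‖`). [cite: ReedSimon1972, Thm. VI.23, PDF pp. 198–199] -/
theorem hasSum_inner_of_kernel_expansion {K : X → Y → ℂ} (hK : MemLp (uncurry K) 2 (μ.prod ν))
    {T : Lp ℂ 2 ν →L[ℂ] Lp ℂ 2 μ} (hT : ∀ φ : Lp ℂ 2 ν, (T φ : X → ℂ) =ᵐ[μ] fun x => ∫ y, K x y * φ y ∂ν)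
    {lam : κ → ℂ} {u : κ → X → ℂ} {w : κ → Y → ℂ} (hu : ∀ k, MemLp (u k) 2 μ) (hw : ∀ k, MemLp (w k) 2 ν)
    (hsum : Summable fun k => ‖lam k‖ * (‖(hu k).toLp _‖ * ‖(hw k).toLp _‖))
    (hker : ∀ x y, HasSum (fun k => lam k * (u k x * conj (w k y))) (K x y))
    (η : Lp ℂ 2 μ) (φ : Lp ℂ 2 ν) :
    HasSum (fun k => lam k * (⟪η, (hu k).toLp _⟫_ℂ * ⟪(hw k).toLp _, φ⟫_ℂ)) ⟪η, T φ⟫_ℂ := by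
  -- the double-integral form of the pairing
  have hpair := L2Kernel.inner_op_eq_integral_prod hK hT η φ
  -- the termwise integrands
  set F : κ → X × Y → ℂ := fun k z => lam k * ((conj (η z.1) * u k z.1) * (conj (w k z.2) * φ z.2)) with hF
  have hη2 : MemLp (fun x => conj ((η : X → ℂ) x)) 2 μ := L2Kernel.memLp_two_conj (Lp.memLp η)
  have hw2 : ∀ k, MemLp (fun y => conj (w k y)) 2 ν := fun k => L2Kernel.memLp_two_conj (hw k)
  have hint1 : ∀ k, Integrable (fun x => conj ((η : X → ℂ) x) * u k x) μ := fun k => hη2.integrable_mul (hu k)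
  have hint2 : ∀ k, Integrable (fun y => conj (w k y) * (φ : Y → ℂ) y) ν := fun k =>
    (hw2 k).integrable_mul (Lp.memLp φ)
  have hF_int : ∀ k, Integrable (F k) (μ.prod ν) := fun k => ((hint1 k).mul_prod (hint2 k)).const_mul (lam k)
  -- the summable bound on the `L¹` norms
  have hnormF : ∀ k z, ‖F k z‖ = ‖lam k‖ * ((‖(η : X → ℂ) z.1‖ * ‖u k z.1‖) * (‖w k z.2‖ * ‖(φ : Y → ℂ) z.2‖)) := by
    intro k z
    simp only [hF, norm_mul, Complex.norm_conj]
  have hF_L1 : ∀ k, ∫ z, ‖F k z‖ ∂(μ.prod ν) =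
      ‖lam k‖ * ((∫ x, ‖(η : X → ℂ) x‖ * ‖u k x‖ ∂μ) * (∫ y, ‖w k y‖ * ‖(φ : Y → ℂ) y‖ ∂ν)) := by
    intro k
    rw [integral_congr_ae (Eventually.of_forall (hnormF k)), integral_const_mul,
      integral_prod_mul (fun x => ‖(η : X → ℂ) x‖ * ‖u k x‖) (fun y => ‖w k y‖ * ‖(φ : Y → ℂ) y‖)]
  have hηn : ‖(Lp.memLp η).toLp (η : X → ℂ)‖ = ‖η‖ := by rw [Lp.toLp_coeFn]
  have hφn : ‖(Lp.memLp φ).toLp (φ : Y → ℂ)‖ = ‖φ‖ := by rw [Lp.toLp_coeFn]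
  have hF_le : ∀ k, ∫ z, ‖F k z‖ ∂(μ.prod ν) ≤ ‖η‖ * ‖φ‖ * (‖lam k‖ * (‖(hu k).toLp _‖ * ‖(hw k).toLp _‖)) := by
    intro k
    rw [hF_L1 k]
    have h1 := integral_norm_mul_norm_le_of_memLp_two (Lp.memLp η) (hu k)
    have h2 := integral_norm_mul_norm_le_of_memLp_two (hw k) (Lp.memLp φ)
    rw [hηn] at h1
    rw [hφn] at h2
    have h1' : 0 ≤ ∫ x, ‖(η : X → ℂ) x‖ * ‖u k x‖ ∂μ := integral_nonneg fun x => by positivity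
    have h2' : 0 ≤ ∫ y, ‖w k y‖ * ‖(φ : Y → ℂ) y‖ ∂ν := integral_nonneg fun y => by positivity
    calc ‖lam k‖ * ((∫ x, ‖(η : X → ℂ) x‖ * ‖u k x‖ ∂μ) * (∫ y, ‖w k y‖ * ‖(φ : Y → ℂ) y‖ ∂ν))
        ≤ ‖lam k‖ * ((‖η‖ * ‖(hu k).toLp _‖) * (‖(hw k).toLp _‖ * ‖φ‖)) :=
          mul_le_mul_of_nonneg_left (mul_le_mul h1 h2 h2' (by positivity)) (norm_nonneg _)
      _ = ‖η‖ * ‖φ‖ * (‖lam k‖ * (‖(hu k).toLp _‖ * ‖(hw k).toLp _‖)) := by ring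
  have hF_sum : Summable fun k => ∫ z, ‖F k z‖ ∂(μ.prod ν) :=
    Summable.of_nonneg_of_le (fun k => integral_nonneg fun z => norm_nonneg _) hF_le (hsum.mul_left _)
  -- dominated convergence for series
  have hDC := hasSum_integral_of_summable_integral_norm hF_int hF_sum
  -- the sum of the integrands is the double integrand of the pairing
  have htsum : ∀ z : X × Y, ∑' k, F k z = conj ((η : X → ℂ) z.1) * (K z.1 z.2 * (φ : Y → ℂ) z.2) := by
    intro z
    have h := ((hker z.1 z.2).mul_left (conj ((η : X → ℂ) z.1))).mul_right ((φ : Y → ℂ) z.2)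
    have h' : HasSum (fun k => F k z) (conj ((η : X → ℂ) z.1) * K z.1 z.2 * (φ : Y → ℂ) z.2) := by
      refine h.congr_fun fun k => ?_
      simp only [hF]
      ring
    rw [h'.tsum_eq]
    ring
  rw [integral_congr_ae (Eventually.of_forall htsum), ← hpair] at hDC
  -- each integral is the product of the two pairings
  refine hDC.congr_fun fun k => ?_
  change lam k * (⟪η, (hu k).toLp _⟫_ℂ * ⟪(hw k).toLp _, φ⟫_ℂ) = ∫ z, F k z ∂(μ.prod ν)
  rw [hF]
  simp only []
  rw [integral_const_mul, integral_prod_mul (fun x => conj ((η : X → ℂ) x) * u k x)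
    (fun y => conj (w k y) * (φ : Y → ℂ) y)]
  congr 1
  congr 1
  · rw [L2.inner_def]
    refine integral_congr_ae ?_
    filter_upwards [(hu k).coeFn_toLp] with x hx
    rw [RCLike.inner_apply', hx]
  · rw [L2.inner_def]
    refine integral_congr_ae ?_
    filter_upwards [(hw k).coeFn_toLp] with y hy
    rw [RCLike.inner_apply', hy]

/-- **Strong form: the operator IS the norm-convergent sum of the rank-one operators.**  Under the
hypotheses of `hasSum_inner_of_kernel_expansion`, for every `φ`:
`T φ = Σ_k λ_k ⟨w_k, φ⟩ u_k` in `L²(X)` (the series converges absolutely in norm, and its sum has the same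
pairings with every `η` as `Tφ`). [cite: ReedSimon1972, Thm. VI.23, PDF pp. 198–199] -/
theorem hasSum_rankOne_of_kernel_expansion {K : X → Y → ℂ} (hK : MemLp (uncurry K) 2 (μ.prod ν))
    {T : Lp ℂ 2 ν →L[ℂ] Lp ℂ 2 μ} (hT : ∀ φ : Lp ℂ 2 ν, (T φ : X → ℂ) =ᵐ[μ] fun x => ∫ y, K x y * φ y ∂ν)
    {lam : κ → ℂ} {u : κ → X → ℂ} {w : κ → Y → ℂ} (hu : ∀ k, MemLp (u k) 2 μ) (hw : ∀ k, MemLp (w k) 2 ν)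
    (hsum : Summable fun k => ‖lam k‖ * (‖(hu k).toLp _‖ * ‖(hw k).toLp _‖))
    (hker : ∀ x y, HasSum (fun k => lam k * (u k x * conj (w k y))) (K x y)) (φ : Lp ℂ 2 ν) :
    HasSum (fun k => (lam k * ⟪(hw k).toLp _, φ⟫_ℂ) • (hu k).toLp _) (T φ) := by
  -- absolute convergence in norm
  have hS : Summable fun k => (lam k * ⟪(hw k).toLp _, φ⟫_ℂ) • (hu k).toLp (u k) := by
    refine Summable.of_norm_bounded (hsum.mul_left ‖φ‖) fun k => ?_
    rw [norm_smul, norm_mul]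
    calc ‖lam k‖ * ‖⟪(hw k).toLp _, φ⟫_ℂ‖ * ‖(hu k).toLp (u k)‖
        ≤ ‖lam k‖ * (‖(hw k).toLp _‖ * ‖φ‖) * ‖(hu k).toLp (u k)‖ :=
          mul_le_mul_of_nonneg_right (mul_le_mul_of_nonneg_left (norm_inner_le_norm _ _) (norm_nonneg _))
            (norm_nonneg _)
      _ = ‖φ‖ * (‖lam k‖ * (‖(hu k).toLp _‖ * ‖(hw k).toLp _‖)) := by ring
  have hH := hS.hasSum
  -- identify the sum by its pairings
  have heq : ∑' k, (lam k * ⟪(hw k).toLp _, φ⟫_ℂ) • (hu k).toLp (u k) = T φ := by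
    refine ext_inner_left ℂ fun η => ?_
    have h1 := (hH.mapL (innerSL ℂ η)).tsum_eq
    simp only [innerSL_apply_apply] at h1
    rw [← h1]
    have h2 := (hasSum_inner_of_kernel_expansion hK hT hu hw hsum hker η φ).tsum_eq
    rw [← h2]
    refine tsum_congr fun k => ?_
    rw [inner_smul_right]
    ring
  rwa [heq] at hH

end Literature.Analysis.OperatorTheory
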